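import Literature.Probability.LatticeModels.CurrentPartitionMonotone
import Literature.Probability.LatticeModels.WeightedClusterDecomposition
import HarnessLib

/-!
# Cluster-conditioned current masses: splice identities and Griffiths monotonicity

Topic `Literature/Probability/LatticeModels`; edge couplings `K ≥ 0` on a finite simple graph `G`
(`WeightedCurrents.lean`). For a vertex `a`, a vertex set `C ∋ a` and a set `X` of deleted vertices write

  `M_X[A](C) = cmass K X A a C = ∑_{n ⊆ G∖X, ∂n = A, C_n(a) = C} w_K(n)`

(currents of `G` vanishing on every edge meeting `X`, with sources `A` and cluster of `a` equal to `C`;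
`X = ∅`: all currents) and `Z_{G∖S}[B] = ecurrentSumIn (offGraph G S) K B`. Freezing the cluster `C`, a current
splits into its part on the edges meeting `C` and an independent current supported off `C`; exchanging the
outer parts of two currents (`Current.spliceOff`, `Current.splice_transfer` of `WeightedClusterDecomposition.lean`)
is a weight-preserving involution. This gives the two identities (for `A ⊆ C`)

* `cmass_mul_ecurrentSumIn_sources_eq` — moving sources `B` off `C` into the conditioned current:
  `M_X[A](C) · Z_{G∖(X∪C)}[B] = M_X[A ∪ B](C) · Z_{G∖(X∪C)}[∅]`      (`B ∩ C = ∅`);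
* `cmass_empty_mul_ecurrentSumIn_eq` — conditioning does not see the deleted far-away edges:
  `M_∅[A](C) · Z_{G∖(X∪C)}[∅] = M_X[A](C) · Z_{G∖C}[∅]`              (`C ∩ X = ∅`),

and, with the supermodularity `Z_{G∖C}[∅] Z_{G∖X}[∅] ≤ Z_G[∅] Z_{G∖(X∪C)}[∅]` of
`CurrentPartitionMonotone.lean` (Griffiths II), the **monotonicity of the cluster-conditioned probabilities under
deletion of far-away edges**, `M_∅[A](C)/Z_G[∅] ≤ M_X[A](C)/Z_{G∖X}[∅]` (`cmass_empty_mul_le`), i.e.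
`P^{A}_{G}[C_n(a) = C] ⟨σ_A⟩_G ≤ P^{A}_{G∖X}[C_n(a) = C] ⟨σ_A⟩_{G∖X}` for `C ∩ X = ∅` — the random-current
counterpart of the super-multiplicativity `g(ω₁∘ω₂) ≥ g(ω₁)g(ω₂)` of the weights of Aizenman's random-walk
representation (Aizenman 1982, Lemma 9.3), which is the Griffiths-inequality input of his bound on the
deviation from Wick's law (Prop. 12.1). These are the inputs of `AizenmanWickCurrents.lean`.

## References

* M. Aizenman, *Geometric analysis of φ⁴ fields and Ising models*, Comm. Math. Phys. 86 (1982), §5 (conditioning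
  on clusters), Lemma 9.2, Lemma 9.3 [AizenmanCMP1982] (read, pp. 23–27, 36–39); the formal statements are ours.
* R. Panis, arXiv:2309.05797 (2023), §4.2 [Panis2023Triviality].
-/

noncomputable section

open Finset Filter
open scoped symmDiff ENNReal

namespace Literature.Probability.LatticeModels

variable {V : Type*} [Fintype V] [DecidableEq V] {G : SimpleGraph V} [DecidableRel G.Adj]

/-- Reindexing a `tsum` of indicator-restricted weights along an involution exchanging the constraint sets
and preserving the weights. [folklore] -/
theorem tsum_ite_eq_of_involutive {α : Type*} (f : α → α) (hf : Function.Involutive f)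
    (PA PB : α → Prop) [DecidablePred PA] [DecidablePred PB] (wA wB : α → ℝ≥0∞)
    (hAB : ∀ q, PA q → PB (f q)) (hBA : ∀ q, PB q → PA (f q)) (hw : ∀ q, PA q → wA q = wB (f q)) :
    ∑' q, (if PA q then wA q else 0) = ∑' q, (if PB q then wB q else 0) := by
  rw [← (hf.toPerm f).tsum_eq (fun q => if PB q then wB q else 0)]
  refine tsum_congr fun q => ?_
  change (if PA q then wA q else 0) = (if PB (f q) then wB (f q) else 0)
  by_cases h : PA q
  · rw [if_pos h, if_pos (hAB q h), hw q h]
  · have h' : ¬ PB (f q) := fun h' => h (by simpa [hf q] using hBA (f q) h')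
    rw [if_neg h, if_neg h']

namespace Current

/-! ### Supports of spliced currents -/

/-- Every current is supported off the empty vertex set. [folklore] -/
theorem isSupp_offGraph_empty (n : Current G) : IsSupp (offGraph G ∅) n :=
  isSupp_offGraph_iff.2 fun _ he => absurd (fun v _ => Finset.notMem_empty v) he

/-- Supported off `X ∪ S` iff supported off `X` and off `S`. [folklore] -/
theorem isSupp_offGraph_union_iff {X S : Finset V} {n : Current G} :
    IsSupp (offGraph G (X ∪ S)) n ↔ IsSupp (offGraph G X) n ∧ IsSupp (offGraph G S) n := by
  simp only [isSupp_offGraph_iff, edgeOff_union_iff, not_and_or]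
  exact ⟨fun h => ⟨fun e he => h e (Or.inl he), fun e he => h e (Or.inr he)⟩,
    fun h e he => he.elim (h.1 e) (h.2 e)⟩

/-- Splicing two currents supported off `X` gives a current supported off `X`. [folklore] -/
theorem isSupp_offGraph_spliceOff {X S : Finset V} {n k : Current G} (hn : IsSupp (offGraph G X) n)
    (hk : IsSupp (offGraph G X) k) : IsSupp (offGraph G X) (spliceOff S n k) := by
  rw [isSupp_offGraph_iff] at hn hk ⊢
  intro e he
  by_cases hS : EdgeOff S (e : Sym2 V)
  · rw [spliceOff_apply_of_edgeOff _ _ hS]; exact hk e he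
  · rw [spliceOff_apply_of_not_edgeOff _ _ hS]; exact hn e he

/-- The current equal to `k` (supported off `C`) on the edges meeting `C` and to `n` (supported off `X`)
elsewhere is supported off `X`. [folklore] -/
theorem isSupp_offGraph_spliceOff_of_isSupp {X C : Finset V} {k n : Current G} (hk : IsSupp (offGraph G C) k)
    (hn : IsSupp (offGraph G X) n) : IsSupp (offGraph G X) (spliceOff C k n) := by
  rw [isSupp_offGraph_iff] at hk hn ⊢
  intro e he
  by_cases hS : EdgeOff C (e : Sym2 V)
  · rw [spliceOff_apply_of_edgeOff _ _ hS]; exact hn e he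
  · rw [spliceOff_apply_of_not_edgeOff _ _ hS]; exact hk e hS

/-- If `C = C_n(a)` is disjoint from `X`, the current equal to `n` on the edges meeting `C` and to a current
`k` supported off `X` elsewhere is supported off `X`: an edge meeting both `C` and `X` leaves the cluster, so `n`
vanishes there. [folklore] -/
theorem isSupp_offGraph_spliceOff_of_cluster {X C : Finset V} {n k : Current G} {a : V}
    (hC : n.cluster a = C) (hCX : Disjoint C X) (hk : IsSupp (offGraph G X) k) :
    IsSupp (offGraph G X) (spliceOff C n k) := by
  rw [isSupp_offGraph_iff] at hk ⊢
  intro e he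
  by_cases hS : EdgeOff C (e : Sym2 V)
  · rw [spliceOff_apply_of_edgeOff _ _ hS]; exact hk e he
  · rw [spliceOff_apply_of_not_edgeOff _ _ hS]
    -- `e` has an endpoint `c ∈ C` and an endpoint `v ∈ X`, `v ∉ C`
    simp only [EdgeOff, not_forall, not_not, exists_prop] at hS he
    obtain ⟨c, hce, hcC⟩ := hS
    obtain ⟨v, hve, hvX⟩ := he
    have hvC : v ∉ C := Finset.disjoint_right.1 hCX hvX
    have hew : (e : Sym2 V) = s(c, Sym2.Mem.other hce) := (Sym2.other_spec hce).symm
    have hv : v = Sym2.Mem.other hce := by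
      have h := hve
      rw [hew, Sym2.mem_iff] at h
      exact h.resolve_left fun h => hvC (h ▸ hcC)
    exact apply_eq_zero_of_cluster_eq hC hew hcC (hv ▸ hvC)

/-- **The splice transfer for a single current** (`Current.splice_transfer` with first current `0`): if
`C_n(a) = C` and `k` is supported off `C`, then `n' = spliceOff C n k` and `k' = spliceOff C k n` satisfy
`C_{n'}(a) = C`, `k'` is supported off `C`, `∂k' = ∂n ∖ C`, `∂n' = (∂n ∩ C) ∪ (∂k ∖ C)`. [folklore] -/
theorem splice_transfer₀ {n k : Current G} {a : V} {C : Finset V} (hC : n.cluster a = C)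
    (hk : IsSupp (offGraph G C) k) :
    (spliceOff C n k).cluster a = C ∧ IsSupp (offGraph G C) (spliceOff C k n) ∧
      (spliceOff C k n).sources = n.sources.filter (· ∉ C) ∧
      (spliceOff C n k).sources = n.sources.filter (· ∈ C) ∪ k.sources.filter (· ∉ C) := by
  have h := splice_transfer (n₁ := (0 : Current G)) (n₂ := n) (k := k) (x := a) (S := C) (by rwa [zero_add]) hk
  simpa only [zero_add] using h

/-- A current supported off `S` has no sources in `S`. [folklore] -/
theorem disjoint_sources_of_isSupp_offGraph {S : Finset V} {n : Current G} (hn : IsSupp (offGraph G S) n) :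
    Disjoint n.sources S := by
  rw [isSupp_offGraph_iff] at hn
  rw [Finset.disjoint_right]
  intro v hvS hv
  rw [mem_sources_iff] at hv
  have hdeg : n.degree v = 0 := by
    refine Finset.sum_eq_zero fun e _ => ?_
    by_cases hve : v ∈ (e : Sym2 V)
    · rw [if_pos hve]; exact hn e fun ho => ho v hve hvS
    · rw [if_neg hve]
  rw [hdeg] at hv
  exact Nat.not_odd_zero hv

/-! ### Cluster-conditioned masses -/

variable {K : G.edgeFinset → ℝ}

/-- **The cluster-conditioned mass** `M_X[A](C) = ∑_{n ⊆ G∖X, ∂n = A, C_n(a) = C} w_K(n)`: currents of `G`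
supported off `X`, with sources `A` and cluster of `a` equal to `C` (`ℝ≥0∞`). [cite: AizenmanCMP1982, §5 (conditioning on the cluster)] -/
def cmass (K : G.edgeFinset → ℝ) (X A : Finset V) (a : V) (C : Finset V) : ℝ≥0∞ :=
  ∑' n : Current G, if IsSupp (offGraph G X) n ∧ n.sources = A ∧ n.cluster a = C then n.eweight K else 0

/-- `M_X[A](C) ≤ Z_{G∖X}[A]`. [folklore] -/
theorem cmass_le_ecurrentSumIn (K : G.edgeFinset → ℝ) (X A : Finset V) (a : V) (C : Finset V) :
    cmass K X A a C ≤ ecurrentSumIn (offGraph G X) K A := by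
  unfold cmass ecurrentSumIn
  refine ENNReal.tsum_le_tsum fun n => ?_
  by_cases h : IsSupp (offGraph G X) n ∧ n.sources = A ∧ n.cluster a = C
  · rw [if_pos h, if_pos ⟨h.1, h.2.1⟩]
  · rw [if_neg h]; exact bot_le

/-- A product of two indicator-restricted `tsum`s as one `tsum` over pairs. [folklore] -/
theorem tsum_ite_mul_tsum_ite {α γ : Type*} (P : α → Prop) (Q : γ → Prop) [DecidablePred P] [DecidablePred Q]
    (f : α → ℝ≥0∞) (g : γ → ℝ≥0∞) :
    (∑' a, if P a then f a else 0) * (∑' b, if Q b then g b else 0) =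
      ∑' q : α × γ, if P q.1 ∧ Q q.2 then f q.1 * g q.2 else 0 := by
  rw [tsum_mul_tsum_eq_tsum_prod]
  exact tsum_congr fun q => ite_zero_mul_ite_zero _ _ _ _

/-- **Moving sources into the conditioned current.** For `A ⊆ C` and `B ∩ C = ∅`:
`M_X[A](C) · Z_{G∖(X∪C)}[B] = M_X[A ∪ B](C) · Z_{G∖(X∪C)}[∅]` — the involution
`(n, k) ↦ (spliceOff C n k, spliceOff C k n)` trades the part of `n` off its cluster `C` (no sources) against the
current `k` (sources `B`, all off `C`), preserving `w(n)w(k)`, the cluster of `a` and the support off `X`.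
[cite: AizenmanCMP1982, Lemma 9.2] -/
theorem cmass_mul_ecurrentSumIn_sources_eq (hK : ∀ e, 0 ≤ K e) {X C A B : Finset V} {a : V}
    (hAC : A ⊆ C) (hBC : Disjoint B C) :
    cmass K X A a C * ecurrentSumIn (offGraph G (X ∪ C)) K B =
      cmass K X (A ∪ B) a C * ecurrentSumIn (offGraph G (X ∪ C)) K ∅ := by
  unfold cmass ecurrentSumIn
  rw [tsum_ite_mul_tsum_ite, tsum_ite_mul_tsum_ite]
  have hfilt1 : A.filter (· ∉ C) = ∅ := Finset.filter_false_of_mem fun v hv h => h (hAC hv)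
  have hfilt2 : A.filter (· ∈ C) = A := Finset.filter_true_of_mem fun v hv => hAC hv
  have hfilt3 : B.filter (· ∉ C) = B := Finset.filter_true_of_mem fun v hv h => Finset.disjoint_left.1 hBC hv h
  have hfilt4 : B.filter (· ∈ C) = ∅ := Finset.filter_false_of_mem fun v hv h => Finset.disjoint_left.1 hBC hv h
  refine tsum_ite_eq_of_involutive (fun q => (spliceOff C q.1 q.2, spliceOff C q.2 q.1))
    (fun q => by simp only [spliceOff_spliceOff]) _ _ _ _ (fun q hq => ?_) (fun q hq => ?_) (fun q hq => ?_)
  · obtain ⟨⟨hnX, hnA, hnC⟩, hkXC, hkB⟩ := hq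
    obtain ⟨hkX, hkC⟩ := isSupp_offGraph_union_iff.1 hkXC
    obtain ⟨hC', hk', hsk', hsn'⟩ := splice_transfer₀ hnC hkC
    refine ⟨⟨isSupp_offGraph_spliceOff hnX hkX, ?_, hC'⟩, isSupp_offGraph_union_iff.2
      ⟨isSupp_offGraph_spliceOff hkX hnX, hk'⟩, ?_⟩
    · rw [hsn', hnA, hkB, hfilt2, hfilt3]
    · rw [hsk', hnA, hfilt1]
  · obtain ⟨⟨hnX, hnA, hnC⟩, hkXC, hkB⟩ := hq
    obtain ⟨hkX, hkC⟩ := isSupp_offGraph_union_iff.1 hkXC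
    obtain ⟨hC', hk', hsk', hsn'⟩ := splice_transfer₀ hnC hkC
    refine ⟨⟨isSupp_offGraph_spliceOff hnX hkX, ?_, hC'⟩, isSupp_offGraph_union_iff.2
      ⟨isSupp_offGraph_spliceOff hkX hnX, hk'⟩, ?_⟩
    · rw [hsn', hnA, hkB, Finset.filter_union, hfilt2, hfilt4, Finset.filter_empty, Finset.union_empty,
        Finset.union_empty]
    · rw [hsk', hnA, Finset.filter_union, hfilt1, hfilt3, Finset.empty_union]
  · exact (eweight_spliceOff_mul_eweight_spliceOff hK C q.1 q.2).symm

/-- **Conditioning on the cluster does not see deleted far-away edges.** For `C ∩ X = ∅` and `A ⊆ C`: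
`M_∅[A](C) · Z_{G∖(X∪C)}[∅] = M_X[A](C) · Z_{G∖C}[∅]` — the same involution trades the outer (sourceless) part of
an unrestricted current `n` with `C_n(a) = C` against a sourceless current off `X ∪ C`; the part of `n` on the
edges meeting `C` avoids `X` (an edge meeting `C` and `X` leaves the cluster). [cite: AizenmanCMP1982, Lemma 9.2] -/
theorem cmass_empty_mul_ecurrentSumIn_eq (hK : ∀ e, 0 ≤ K e) {X C A : Finset V} {a : V}
    (hCX : Disjoint C X) (hAC : A ⊆ C) :
    cmass K ∅ A a C * ecurrentSumIn (offGraph G (X ∪ C)) K ∅ =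
      cmass K X A a C * ecurrentSumIn (offGraph G C) K ∅ := by
  unfold cmass ecurrentSumIn
  rw [tsum_ite_mul_tsum_ite, tsum_ite_mul_tsum_ite]
  have hfilt1 : A.filter (· ∉ C) = ∅ := Finset.filter_false_of_mem fun v hv h => h (hAC hv)
  have hfilt2 : A.filter (· ∈ C) = A := Finset.filter_true_of_mem fun v hv => hAC hv
  refine tsum_ite_eq_of_involutive (fun q => (spliceOff C q.1 q.2, spliceOff C q.2 q.1))
    (fun q => by simp only [spliceOff_spliceOff]) _ _ _ _ (fun q hq => ?_) (fun q hq => ?_) (fun q hq => ?_)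
  · obtain ⟨⟨-, hnA, hnC⟩, hkXC, hk0⟩ := hq
    obtain ⟨hkX, hkC⟩ := isSupp_offGraph_union_iff.1 hkXC
    obtain ⟨hC', hk', hsk', hsn'⟩ := splice_transfer₀ hnC hkC
    refine ⟨⟨isSupp_offGraph_spliceOff_of_cluster hnC hCX hkX, ?_, hC'⟩, hk', ?_⟩
    · rw [hsn', hnA, hk0, hfilt2, Finset.filter_empty, Finset.union_empty]
    · rw [hsk', hnA, hfilt1]
  · obtain ⟨⟨hnX, hnA, hnC⟩, hkC, hk0⟩ := hq
    obtain ⟨hC', hk', hsk', hsn'⟩ := splice_transfer₀ hnC hkC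
    refine ⟨⟨isSupp_offGraph_empty _, ?_, hC'⟩, isSupp_offGraph_union_iff.2
      ⟨isSupp_offGraph_spliceOff_of_isSupp hkC hnX, hk'⟩, ?_⟩
    · rw [hsn', hnA, hk0, hfilt2, Finset.filter_empty, Finset.union_empty]
    · rw [hsk', hnA, hfilt1]
  · exact (eweight_spliceOff_mul_eweight_spliceOff hK C q.1 q.2).symm

/-- `M_X[A](C) = 0` unless `a ∈ C` (`a ∈ C_n(a)`). [folklore] -/
theorem cmass_eq_zero_of_not_mem_self (K : G.edgeFinset → ℝ) {X A C : Finset V} {a : V} (ha : a ∉ C) :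
    cmass K X A a C = 0 := by
  unfold cmass
  refine ENNReal.tsum_eq_zero.2 fun n => if_neg fun h => ha ?_
  rw [← h.2.2]; exact mem_cluster_self n a

/-- `M_X[{a}Δ{c}](C) = 0` unless `c ∈ C` (the two sources of a pair current are connected). [folklore] -/
theorem cmass_pair_eq_zero_of_not_mem (K : G.edgeFinset → ℝ) {X C : Finset V} {a c : V} (hc : c ∉ C) :
    cmass K X ({a} ∆ {c}) a C = 0 := by
  unfold cmass
  refine ENNReal.tsum_eq_zero.2 fun n => if_neg fun h => hc ?_
  rw [← h.2.2]; exact mem_cluster_of_sources_eq h.2.1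

/-- **Resolving a `tsum` by the value of a cluster**: `∑_n f(n) g(C_n(a)) = ∑_C (∑_n f(n) 𝟙[C_n(a) = C]) g(C)`.
[folklore] -/
theorem tsum_mul_apply_cluster_eq_sum (f : Current G → ℝ≥0∞) (g : Finset V → ℝ≥0∞) (a : V) :
    ∑' n, f n * g (n.cluster a) = ∑ C : Finset V, (∑' n, f n * (if n.cluster a = C then 1 else 0)) * g C := by
  have h : ∀ n : Current G, f n * g (n.cluster a) = ∑ C : Finset V, f n * (if n.cluster a = C then 1 else 0) * g C := by
    intro n
    rw [Finset.sum_eq_single (n.cluster a) (fun C _ hC => by rw [if_neg (Ne.symm hC), mul_zero, zero_mul])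
      (fun h => absurd (Finset.mem_univ _) h), if_pos rfl, mul_one]
  rw [tsum_congr h, Summable.tsum_finsetSum (fun _ _ => ENNReal.summable)]
  exact Finset.sum_congr rfl fun C _ => ENNReal.tsum_mul_right

/-- `∑_C M_X[A](C) = Z_{G∖X}[A]`. [folklore] -/
theorem sum_cmass_eq (K : G.edgeFinset → ℝ) (X A : Finset V) (a : V) :
    ∑ C : Finset V, cmass K X A a C = ecurrentSumIn (offGraph G X) K A := by
  have h := tsum_mul_apply_cluster_eq_sum
    (fun n : Current G => if IsSupp (offGraph G X) n ∧ n.sources = A then n.eweight K else 0) (fun _ => 1) a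
  simp only [mul_one] at h
  rw [ecurrentSumIn, h]
  refine Finset.sum_congr rfl fun C _ => ?_
  unfold cmass
  refine tsum_congr fun n => ?_
  by_cases h1 : IsSupp (offGraph G X) n ∧ n.sources = A <;> by_cases h2 : n.cluster a = C
  · rw [if_pos h1, if_pos h2, if_pos ⟨h1.1, h1.2, h2⟩, mul_one]
  · rw [if_neg h2, if_neg (fun h => h2 h.2.2), mul_zero]
  · rw [if_neg h1, if_neg (fun h => h1 ⟨h.1, h.2.1⟩), zero_mul]
  · rw [if_neg h1, if_neg (fun h => h1 ⟨h.1, h.2.1⟩), zero_mul]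

/-- `Z_{G₁}[∅]` is neither `0` nor `∞`. [folklore] -/
theorem ecurrentSumIn_empty_ne_zero (G₁ : SimpleGraph V) [DecidableRel G₁.Adj] (K : G.edgeFinset → ℝ) :
    ecurrentSumIn G₁ K (∅ : Finset V) ≠ 0 :=
  (lt_of_lt_of_le zero_lt_one (one_le_ecurrentSumIn_empty G₁ K)).ne'

/-- **Monotonicity of the cluster-conditioned probabilities under deletion of far-away edges** (Griffiths II;
the random-current form of Aizenman 1982, Lemma 9.3): for `C ∩ X = ∅` and `A ⊆ C`,
`M_∅[A](C) · Z_{G∖X}[∅] ≤ M_X[A](C) · Z_G[∅]`, i.e. `P^A_G[C_n(a) = C]⟨σ_A⟩_G ≤ P^A_{G∖X}[C_n(a) = C]⟨σ_A⟩_{G∖X}`: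
by `cmass_empty_mul_ecurrentSumIn_eq` both sides carry the same conditioned inner part, and the outer partition
functions compare by `Z_{G∖C}[∅] Z_{G∖X}[∅] ≤ Z_G[∅] Z_{G∖(X∪C)}[∅]` (`ecurrentSumIn_offGraph_empty_mul_le`).
[cite: AizenmanCMP1982, Lemma 9.3] -/
theorem cmass_empty_mul_le (hK : ∀ e, 0 ≤ K e) {X C A : Finset V} {a : V} (hCX : Disjoint C X) (hAC : A ⊆ C) :
    cmass K ∅ A a C * ecurrentSumIn (offGraph G X) K ∅ ≤ cmass K X A a C * ecurrentSum K ∅ := by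
  have hne0 := ecurrentSumIn_empty_ne_zero (offGraph G (X ∪ C)) K
  have hnetop : ecurrentSumIn (offGraph G (X ∪ C)) K ∅ ≠ ∞ := ecurrentSumIn_ne_top _ hK ∅
  rw [← ENNReal.mul_le_mul_iff_right hne0 hnetop]
  calc ecurrentSumIn (offGraph G (X ∪ C)) K ∅ * (cmass K ∅ A a C * ecurrentSumIn (offGraph G X) K ∅)
      = (cmass K ∅ A a C * ecurrentSumIn (offGraph G (X ∪ C)) K ∅) * ecurrentSumIn (offGraph G X) K ∅ := by ring
    _ = cmass K X A a C * (ecurrentSumIn (offGraph G C) K ∅ * ecurrentSumIn (offGraph G X) K ∅) := by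
        rw [cmass_empty_mul_ecurrentSumIn_eq hK hCX hAC, mul_assoc]
    _ ≤ cmass K X A a C * (ecurrentSum K ∅ * ecurrentSumIn (offGraph G (X ∪ C)) K ∅) :=
        mul_le_mul' le_rfl (ecurrentSumIn_offGraph_empty_mul_le' hK X C)
    _ = ecurrentSumIn (offGraph G (X ∪ C)) K ∅ * (cmass K X A a C * ecurrentSum K ∅) := by ring

/-- **The two steps combined**: for `C ∩ X = ∅`, `A ⊆ C`, `B ∩ C = ∅`,
`M_∅[A](C) · Z_{G∖X}[∅] · Z_{G∖(X∪C)}[B] ≤ Z_G[∅] · M_X[A ∪ B](C) · Z_{G∖(X∪C)}[∅]`.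
[cite: AizenmanCMP1982, Lemma 9.2 and Lemma 9.3] -/
theorem cmass_empty_mul_mul_le (hK : ∀ e, 0 ≤ K e) {X C A B : Finset V} {a : V} (hCX : Disjoint C X)
    (hAC : A ⊆ C) (hBC : Disjoint B C) :
    cmass K ∅ A a C * ecurrentSumIn (offGraph G X) K ∅ * ecurrentSumIn (offGraph G (X ∪ C)) K B ≤
      ecurrentSum K ∅ * (cmass K X (A ∪ B) a C * ecurrentSumIn (offGraph G (X ∪ C)) K ∅) := by
  calc cmass K ∅ A a C * ecurrentSumIn (offGraph G X) K ∅ * ecurrentSumIn (offGraph G (X ∪ C)) K B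
      ≤ cmass K X A a C * ecurrentSum K ∅ * ecurrentSumIn (offGraph G (X ∪ C)) K B :=
        mul_le_mul' (cmass_empty_mul_le hK hCX hAC) le_rfl
    _ = ecurrentSum K ∅ * (cmass K X A a C * ecurrentSumIn (offGraph G (X ∪ C)) K B) := by ring
    _ = ecurrentSum K ∅ * (cmass K X (A ∪ B) a C * ecurrentSumIn (offGraph G (X ∪ C)) K ∅) := by
        rw [cmass_mul_ecurrentSumIn_sources_eq hK hAC hBC]

end Current

end Literature.Probability.LatticeModels

end
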